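import Summits.MatrixMultiplication.OmegaCensus.SmallFormats.RankOnePlaneCapGaugeShear
import Summits.MatrixMultiplication.OmegaCensus.SmallFormats.RankOnePlaneCapGaugeLineTail
import HarnessLib

/-!
# ω-census family (a): the v1.2 gauge with BOTH residual normalisations ('line' tail, 'zero' pinned shear)

Cell `pub-omega` (unit `pub-omega-eng1`, gen 33), topic `Summits/MatrixMultiplication/OmegaCensus`
(sub-folder `SmallFormats`). Framing (verbatim): lottery ticket; floor = certified bounds/negative
ranges. HONEST FRAMING: bookkeeping that types the residual ('third') normalisation of BOTH gauge-SAT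
encoders of the `𝔽₃` `⟨2,2,5⟩@17` X-marginal census (tensor kitjob-gs `JOB_NORM3`, ENG1 x2gs
`JOB_ZSPLIT`), answering tensor g31 (2026-08-28): (a) in the 'zero' position the shear's column-4
SCALING `y` pins the pivot entry to `1` (`shear_normal_form_pinned`: `S(x,y) = [[I₄,0],[x,y]]`,
`y ≠ 0`; `shear_normal_form` only gave `≠ 0`); (b) in the 'line' position the tail columns `3,4`
are normalised by `lineTail_normal_form`. `gauge_normal_form_v12_residual` = `gauge_normal_form_v12`
(head at `i₀ ∈ R₁`) followed by (b) in the line branch and (a) in the zero branch — every case list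
of v1.2 + NORM3 / ZSPLIT is an instance. Pinning `= 1` uses up the per-term sign of the pivot term:
an encoder that also imposes the sign rule on that term must scan the pivot entry first (or read the
pivot as `≠ 0`). Not a bound on any rank, not progress on `ω`.
-/

namespace Summit.MatrixMultiplication.OmegaCensus.RankOnePlaneCapGeneral

open Module Matrix Literature.Computability.AlgebraicComplexity

variable {k : Type*} [Field k] {c m : ℕ} {ι : Type*} [Fintype ι]

/-! ### The scaled shear `S(x, y)` -/

/-- `w ↦ w S(x,y)` (row `4` of `S` = `(x₀,x₁,x₂,x₃,y)`): coordinate `ν ≤ 3` becomes `w_ν + w₄ x_ν`,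
coordinate `4` becomes `w₄ y`. -/
theorem colShearScale_fin5_apply (x : Fin 5 → k) (y : k) (w : Fin 5 → k) :
    let S : Matrix (Fin 5) (Fin 5) k := Matrix.of fun i j =>
      if i = 4 then (if j = 4 then y else x j) else (if i = j then 1 else 0)
    (∀ ν, ν ≠ 4 → (w ᵥ* S) ν = w ν + w 4 * x ν) ∧ (w ᵥ* S) 4 = w 4 * y := by
  intro S
  refine ⟨fun ν hν => ?_, ?_⟩
  · fin_cases ν
    · simp [S, Matrix.vecMul, dotProduct, Fin.sum_univ_five, Matrix.of_apply]
    · simp [S, Matrix.vecMul, dotProduct, Fin.sum_univ_five, Matrix.of_apply]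
    · simp [S, Matrix.vecMul, dotProduct, Fin.sum_univ_five, Matrix.of_apply]
    · simp [S, Matrix.vecMul, dotProduct, Fin.sum_univ_five, Matrix.of_apply]
    · exact absurd rfl hν
  · simp [S, Matrix.vecMul, dotProduct, Fin.sum_univ_five, Matrix.of_apply]

/-- `S'(x,y') S(x,y) = 1` for `y' y = 1` (row `4` of `S'` = `(−y'x₀,…,−y'x₃,y')`), and `Y S' = Y` for
every `Y` with vanishing 5th column. -/
theorem colShearScale_fin5_gauge (x : Fin 5 → k) {y y' : k} (hy : y' * y = 1) :
    let S : Matrix (Fin 5) (Fin 5) k := Matrix.of fun i j =>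
      if i = 4 then (if j = 4 then y else x j) else (if i = j then 1 else 0)
    let S' : Matrix (Fin 5) (Fin 5) k := Matrix.of fun i j =>
      if i = 4 then (if j = 4 then y' else -(y' * x j)) else (if i = j then 1 else 0)
    S' * S = 1 ∧ ∀ Y : Matrix (Fin m) (Fin 5) k, (∀ μ, Y μ 4 = 0) → Y * S' = Y := by
  intro S S'
  refine ⟨?_, fun Y hY => ?_⟩
  · ext i j
    fin_cases i <;> fin_cases j <;>
      simp [S, S', Matrix.mul_apply, Fin.sum_univ_five, Matrix.of_apply, hy]
  · ext μ j
    fin_cases j <;> simp [S', Matrix.mul_apply, Fin.sum_univ_five, Matrix.of_apply, hY μ]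

/-- **Scaled output shear** (the full residual subgroup `[[I₄,0],[x,y]]` of the 'zero' position).
Same X-forms; `g'_i = g_i` on every `Y` with vanishing 5th column; `W'_i[κ][ν] = W_i[κ][ν] +
W_i[κ][4] x_ν` (`ν ≤ 3`), `W'_i[κ][4] = W_i[κ][4] y`. -/
theorem exists_colShearScale (β : BilinComp (mulBilin k c m 5) ι) (x : Fin 5 → k) {y y' : k}
    (hy : y' * y = 1) :
    ∃ β' : BilinComp (mulBilin k c m 5) ι,
      (∀ i, β'.f i = β.f i) ∧
      (∀ i Y, (∀ μ, Y μ 4 = 0) → β'.g i Y = β.g i Y) ∧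
      (∀ i κ ν, ν ≠ 4 → β'.w i κ ν = β.w i κ ν + β.w i κ 4 * x ν) ∧
      (∀ i κ, β'.w i κ 4 = β.w i κ 4 * y) := by
  obtain ⟨hSS, hY⟩ := colShearScale_fin5_gauge (m := m) x hy
  obtain ⟨β', hf, hg, hw⟩ := exists_colTransform β _ _ hSS
  refine ⟨β', hf, fun i Y hY0 => by rw [hg, hY Y hY0], fun i κ ν hν => ?_, fun i κ => ?_⟩
  · obtain ⟨h, -⟩ := colShearScale_fin5_apply x y (β.w i κ)
    rw [hw, mul_apply_eq_vecMul_gen]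
    exact h ν hν
  · obtain ⟨-, h⟩ := colShearScale_fin5_apply x y (β.w i κ)
    rw [hw, mul_apply_eq_vecMul_gen]
    exact h

/-! ### The pinned shear normal form ('zero' position, pivot `= 1`) -/

/-- **Pinned shear normal form** (`shear_normal_form` with the pivot scaled to `1`; any field, any
format `⟨c,m,5⟩`, terms in a linear order). ONE scaled shear gives: same X-forms, `g_i` unchanged on
matrices with zero 5th column, every output row with zero 5th entry unchanged, the zero pattern of the
5th column unchanged, and EITHER every output has zero 5th column OR for the first term `i₁` with a
nonzero 5th-column entry and its first such row `ρ`: `W_{i₁}[ρ] = (0,0,0,0,1) = e₄`. -/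
theorem shear_normal_form_pinned [LinearOrder ι] (β : BilinComp (mulBilin k c m 5) ι) :
    ∃ β' : BilinComp (mulBilin k c m 5) ι,
      (∀ i, β'.f i = β.f i) ∧
      (∀ i Y, (∀ μ, Y μ 4 = 0) → β'.g i Y = β.g i Y) ∧
      (∀ i κ, β'.w i κ 4 = 0 ↔ β.w i κ 4 = 0) ∧
      (∀ i κ, β.w i κ 4 = 0 → β'.w i κ = β.w i κ) ∧
      ((∀ i κ, β'.w i κ 4 = 0) ∨
        ∃ i₁ ρ, β'.w i₁ ρ = Pi.single 4 1 ∧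
          (∀ κ, κ < ρ → β'.w i₁ κ 4 = 0) ∧ (∀ i, i < i₁ → ∀ κ, β'.w i κ 4 = 0)) := by
  classical
  by_cases hall : ∀ i κ, β.w i κ 4 = 0
  · exact ⟨β, fun _ => rfl, fun _ _ _ => rfl, fun _ _ => Iff.rfl, fun _ _ _ => rfl, Or.inl hall⟩
  push Not at hall
  set T : Finset ι := Finset.univ.filter fun i => ∃ κ, β.w i κ 4 ≠ 0 with hTdef
  have hT : T.Nonempty := by
    obtain ⟨i, κ, h⟩ := hall
    exact ⟨i, Finset.mem_filter.mpr ⟨Finset.mem_univ _, κ, h⟩⟩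
  obtain ⟨κ₀, hκ₀⟩ : ∃ κ, β.w (T.min' hT) κ 4 ≠ 0 := (Finset.mem_filter.mp (Finset.min'_mem T hT)).2
  set K : Finset (Fin c) := Finset.univ.filter fun κ => β.w (T.min' hT) κ 4 ≠ 0 with hKdef
  have hK : K.Nonempty := ⟨κ₀, Finset.mem_filter.mpr ⟨Finset.mem_univ _, hκ₀⟩⟩
  have hpiv : β.w (T.min' hT) (K.min' hK) 4 ≠ 0 := (Finset.mem_filter.mp (Finset.min'_mem K hK)).2
  have hbefore : ∀ i, i < T.min' hT → ∀ κ, β.w i κ 4 = 0 := by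
    intro i hi κ
    by_contra h
    have hiT : i ∈ T := Finset.mem_filter.mpr ⟨Finset.mem_univ _, κ, h⟩
    exact absurd hi (not_lt.mpr (Finset.min'_le T i hiT))
  have habove : ∀ κ, κ < K.min' hK → β.w (T.min' hT) κ 4 = 0 := by
    intro κ hκ
    by_contra h
    have hκK : κ ∈ K := Finset.mem_filter.mpr ⟨Finset.mem_univ _, h⟩
    exact absurd hκ (not_lt.mpr (Finset.min'_le K κ hκK))
  -- the scaled shear killing columns `0…3` of the pivot row and scaling the pivot to `1`
  set p : k := β.w (T.min' hT) (K.min' hK) 4 with hpdef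
  obtain ⟨β', hf, hg, hw, hw4⟩ :=
    exists_colShearScale β (fun ν => -(β.w (T.min' hT) (K.min' hK) ν / p)) (y := p⁻¹) (y' := p)
      (mul_inv_cancel₀ hpiv)
  have hiff : ∀ i κ, β'.w i κ 4 = 0 ↔ β.w i κ 4 = 0 := fun i κ => by
    rw [hw4, mul_eq_zero, or_iff_left (inv_ne_zero hpiv)]
  refine ⟨β', hf, hg, hiff, fun i κ h0 => ?_, Or.inr ⟨T.min' hT, K.min' hK, ?_, fun κ hκ => ?_,
    fun i hi κ => ?_⟩⟩
  · ext ν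
    by_cases hν : ν = 4
    · rw [hν, hw4, h0, zero_mul]
    · rw [hw i κ ν hν, h0, zero_mul, add_zero]
  · funext ν
    by_cases hν : ν = 4
    · rw [hν, hw4, Pi.single_eq_same]; exact mul_inv_cancel₀ hpiv
    · rw [hw _ _ ν hν, Pi.single_eq_of_ne hν]; exact add_mul_neg_div_eq_zero _ _ hpiv
  · rw [hiff]; exact habove κ hκ
  · rw [hiff]; exact hbefore i hi κ

/-- The `θᵀG_i`-coordinates `0,1,2` are unchanged by a transform that keeps every `g_i` on matrices
with vanishing columns `3,4`. -/
theorem vecMul_gMatrix_eq_of_agree34 {β β' : BilinComp (mulBilin k c m 5) ι}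
    (hg : ∀ i (Y : Matrix (Fin m) (Fin 5) k), (∀ μ, Y μ 3 = 0 ∧ Y μ 4 = 0) → β'.g i Y = β.g i Y)
    (θ : Fin m → k) (i : ι) {ν : Fin 5} (h3 : ν ≠ 3) (h4 : ν ≠ 4) :
    (θ ᵥ* Matrix.of fun μ ν => β'.g i (Matrix.single μ ν (1 : k))) ν =
      (θ ᵥ* Matrix.of fun μ ν => β.g i (Matrix.single μ ν (1 : k))) ν := by
  simp only [Matrix.vecMul, dotProduct, Matrix.of_apply]
  refine Finset.sum_congr rfl fun μ _ => ?_
  rw [hg i _ fun μ' => ⟨Matrix.single_apply_of_col_ne μ μ' h3 (1 : k),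
    Matrix.single_apply_of_col_ne μ μ' h4 (1 : k)⟩]

/-! ### The v1.2 gauge with both residual normalisations (`𝔽₃`, `⟨2,2,5⟩`, 17 products) -/

/-- **`gauge_normal_form_v12` + line-tail + pinned shear** (what a census word obtained with the
residual normalisation cites). Hypotheses of `gauge_normal_form_v12`, head at `i₀ ∈ R₁`, terms in a
linear order. Conclusion: same X-forms, the `R₁` block and `θ₁` zeros, and EITHER the 'line' data
(`R₂`-support `{0,2}`, `θ₂` zeros in coordinates `0,2`, Borel head) WITH the line-tail alternative
(all tails zero, or first-tail term `i₁ ∉ R₁ ∪ R₂` in form LT2 / LT1 / LT1′), OR the 'zero' data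
(`R₂`-support `{2,3}`, `θ₂` zeros in `2,3`, `GL₂` head) WITH the pinned-shear alternative (all 5th
columns zero, or first term `i₁ ∉ R₁ ∪ R₂` with `W_{i₁}[0] = e₄`, or `W_{i₁}[0][4] = 0` and
`W_{i₁}[1] = e₄`). -/
theorem gauge_normal_form_v12_residual [LinearOrder ι] (h17 : Fintype.card ι = 17)
    (β : BilinComp (mulBilin (ZMod 3) 2 2 5) ι) {lam₁ lam₂ : Fin 2 → ZMod 3}
    (hlam₁ : lam₁ ≠ 0) (hlam₂ : lam₂ ≠ 0) (R₁ R₂ : Finset ι) (hdisj : Disjoint R₁ R₂)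
    (hR₁ : ∀ i ∈ R₁, ∀ z : Fin 2 → ZMod 3, β.f i (vecMulVec z lam₁) = 0)
    (hR₂ : ∀ i ∈ R₂, ∀ z : Fin 2 → ZMod 3, β.f i (vecMulVec z lam₂) = 0)
    (hc₁ : R₁.card = 4) (hc₂ : R₂.card = 4) {i₀ : ι} (hi₀ : i₀ ∈ R₁) :
    ∃ β' : BilinComp (mulBilin (ZMod 3) 2 2 5) ι,
      (∀ i, β'.f i = β.f i) ∧
      (∀ i ∈ R₁, ∀ κ, β'.w i κ 2 = 0 ∧ β'.w i κ 3 = 0 ∧ β'.w i κ 4 = 0) ∧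
      (∃ θ₁ : Fin 2 → ZMod 3, θ₁ ≠ 0 ∧ θ₁ ⬝ᵥ lam₁ = 0 ∧ ∀ i, i ∉ R₁ →
        (θ₁ ᵥ* Matrix.of fun μ ν => β'.g i (Matrix.single μ ν (1 : ZMod 3))) 0 = 0 ∧
        (θ₁ ᵥ* Matrix.of fun μ ν => β'.g i (Matrix.single μ ν (1 : ZMod 3))) 1 = 0) ∧
      (((∀ i ∈ R₂, ∀ κ, β'.w i κ 1 = 0 ∧ β'.w i κ 3 = 0 ∧ β'.w i κ 4 = 0) ∧
          (∃ θ₂ : Fin 2 → ZMod 3, θ₂ ≠ 0 ∧ θ₂ ⬝ᵥ lam₂ = 0 ∧ ∀ i, i ∉ R₂ →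
            (θ₂ ᵥ* Matrix.of fun μ ν => β'.g i (Matrix.single μ ν (1 : ZMod 3))) 0 = 0 ∧
            (θ₂ ᵥ* Matrix.of fun μ ν => β'.g i (Matrix.single μ ν (1 : ZMod 3))) 2 = 0) ∧
          !![β'.w i₀ 0 0, β'.w i₀ 0 1; β'.w i₀ 1 0, β'.w i₀ 1 1] ∈
            ([!![0, 0; 0, 0], !![0, 0; 1, 0], !![0, 0; 0, 1], !![1, 0; 0, 0], !![1, 0; 1, 0],
              !![1, 0; 2, 0], !![0, 1; 0, 0], !![0, 1; 0, 1], !![0, 1; 0, 2], !![1, 0; 0, 1],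
              !![0, 1; 1, 0], !![0, 1; 1, 1], !![0, 1; 1, 2]] :
              List (Matrix (Fin 2) (Fin 2) (ZMod 3))) ∧
          ((∀ i κ, β'.w i κ 3 = 0 ∧ β'.w i κ 4 = 0) ∨
            ∃ i₁, i₁ ∉ R₁ ∧ i₁ ∉ R₂ ∧ (∀ i, i < i₁ → ∀ κ, β'.w i κ 3 = 0 ∧ β'.w i κ 4 = 0) ∧
              ((β'.w i₁ 0 = Pi.single 3 1 ∧ β'.w i₁ 1 = Pi.single 4 1) ∨
               (β'.w i₁ 0 = Pi.single 3 1 ∧ β'.w i₁ 1 4 = 0) ∨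
               ((β'.w i₁ 0 3 = 0 ∧ β'.w i₁ 0 4 = 0) ∧ β'.w i₁ 1 = Pi.single 3 1)))) ∨
       ((∀ i ∈ R₂, ∀ κ, β'.w i κ 0 = 0 ∧ β'.w i κ 1 = 0 ∧ β'.w i κ 4 = 0) ∧
          (∃ θ₂ : Fin 2 → ZMod 3, θ₂ ≠ 0 ∧ θ₂ ⬝ᵥ lam₂ = 0 ∧ ∀ i, i ∉ R₂ →
            (θ₂ ᵥ* Matrix.of fun μ ν => β'.g i (Matrix.single μ ν (1 : ZMod 3))) 2 = 0 ∧
            (θ₂ ᵥ* Matrix.of fun μ ν => β'.g i (Matrix.single μ ν (1 : ZMod 3))) 3 = 0) ∧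
          !![β'.w i₀ 0 0, β'.w i₀ 0 1; β'.w i₀ 1 0, β'.w i₀ 1 1] ∈
            ([!![0, 0; 0, 0], !![1, 0; 0, 0], !![1, 0; 1, 0], !![1, 0; 2, 0], !![0, 0; 1, 0],
              !![1, 0; 0, 1]] : List (Matrix (Fin 2) (Fin 2) (ZMod 3))) ∧
          ((∀ i κ, β'.w i κ 4 = 0) ∨
            ∃ i₁, i₁ ∉ R₁ ∧ i₁ ∉ R₂ ∧ (∀ i, i < i₁ → ∀ κ, β'.w i κ 4 = 0) ∧
              (β'.w i₁ 0 = Pi.single 4 1 ∨ (β'.w i₁ 0 4 = 0 ∧ β'.w i₁ 1 = Pi.single 4 1))))) := by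
  classical
  obtain ⟨β₁, hf₁, hs₁, ⟨θ₁, hθ₁, hθ₁lam, hG₁⟩, hpos⟩ :=
    gauge_normal_form_v12 h17 β hlam₁ hlam₂ R₁ R₂ hdisj hR₁ hR₂ hc₁ hc₂ i₀
  rcases hpos with ⟨hl, ⟨θ₂, hθ₂, hθ₂lam, hG₂⟩, hmem⟩ | ⟨hz, ⟨θ₂, hθ₂, hθ₂lam, hG₂⟩, hmem⟩
  · -- 'line': tail normal form on columns 3,4
    obtain ⟨β₂, hf₂, hg₂, hrow, hnf⟩ := lineTail_normal_form β₁
    have hR₁row : ∀ i ∈ R₁, ∀ κ, β₂.w i κ = β₁.w i κ := fun i hi κ =>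
      hrow i κ ⟨(hs₁ i hi κ).2.1, (hs₁ i hi κ).2.2⟩
    have hR₂row : ∀ i ∈ R₂, ∀ κ, β₂.w i κ = β₁.w i κ := fun i hi κ =>
      hrow i κ ⟨(hl i hi κ).2.1, (hl i hi κ).2.2⟩
    have hG : ∀ (θ : Fin 2 → ZMod 3) (i : ι) (ν : Fin 5), ν ≠ 3 → ν ≠ 4 →
        (θ ᵥ* Matrix.of fun μ ν => β₂.g i (Matrix.single μ ν (1 : ZMod 3))) ν =
          (θ ᵥ* Matrix.of fun μ ν => β₁.g i (Matrix.single μ ν (1 : ZMod 3))) ν :=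
      fun θ i ν h3 h4 => vecMul_gMatrix_eq_of_agree34 hg₂ θ i h3 h4
    refine ⟨β₂, fun i => by rw [hf₂, hf₁], fun i hi κ => by rw [hR₁row i hi κ]; exact hs₁ i hi κ,
      ⟨θ₁, hθ₁, hθ₁lam, fun i hi => ?_⟩, Or.inl ⟨fun i hi κ => by
        rw [hR₂row i hi κ]; exact hl i hi κ, ⟨θ₂, hθ₂, hθ₂lam, fun i hi => ?_⟩,
        by rw [hR₁row i₀ hi₀ 0, hR₁row i₀ hi₀ 1]; exact hmem, ?_⟩⟩
    · rw [hG θ₁ i 0 (by decide) (by decide), hG θ₁ i 1 (by decide) (by decide)]; exact hG₁ i hi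
    · rw [hG θ₂ i 0 (by decide) (by decide), hG θ₂ i 2 (by decide) (by decide)]; exact hG₂ i hi
    · rcases hnf with hall | ⟨i₁, hbefore, hforms⟩
      · exact Or.inl hall
      · have htail₁ : ∀ i ∈ R₁, ∀ κ, β₂.w i κ 3 = 0 := fun i hi κ => by
          rw [hR₁row i hi κ]; exact (hs₁ i hi κ).2.1
        have htail₂ : ∀ i ∈ R₂, ∀ κ, β₂.w i κ 3 = 0 := fun i hi κ => by
          rw [hR₂row i hi κ]; exact (hl i hi κ).2.1
        have hpiv : β₂.w i₁ 0 3 = 1 ∨ β₂.w i₁ 1 3 = 1 := by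
          rcases hforms with ⟨h0, -⟩ | ⟨h0, -⟩ | ⟨-, h1⟩
          · exact Or.inl (by rw [h0]; simp)
          · exact Or.inl (by rw [h0]; simp)
          · exact Or.inr (by rw [h1]; simp)
        have hn : ∀ R : Finset ι, (∀ i ∈ R, ∀ κ, β₂.w i κ 3 = 0) → i₁ ∉ R := by
          intro R hR h
          rcases hpiv with h3 | h3 <;> · rw [hR i₁ h] at h3; exact absurd h3 (by simp)
        exact Or.inr ⟨i₁, hn R₁ htail₁, hn R₂ htail₂, hbefore, hforms⟩
  · -- 'zero': pinned shear on column 4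
    obtain ⟨β₂, hf₂, hg₂, hiff, hrow, hnf⟩ := shear_normal_form_pinned β₁
    have hR₁row : ∀ i ∈ R₁, ∀ κ, β₂.w i κ = β₁.w i κ := fun i hi κ => hrow i κ (hs₁ i hi κ).2.2
    have hR₂row : ∀ i ∈ R₂, ∀ κ, β₂.w i κ = β₁.w i κ := fun i hi κ => hrow i κ (hz i hi κ).2.2
    have hG : ∀ (θ : Fin 2 → ZMod 3) (i : ι) (ν : Fin 5), ν ≠ 4 →
        (θ ᵥ* Matrix.of fun μ ν => β₂.g i (Matrix.single μ ν (1 : ZMod 3))) ν =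
          (θ ᵥ* Matrix.of fun μ ν => β₁.g i (Matrix.single μ ν (1 : ZMod 3))) ν :=
      fun θ i ν hν => vecMul_gMatrix_eq_of_agree hg₂ θ i hν
    refine ⟨β₂, fun i => by rw [hf₂, hf₁], fun i hi κ => by rw [hR₁row i hi κ]; exact hs₁ i hi κ,
      ⟨θ₁, hθ₁, hθ₁lam, fun i hi => ?_⟩, Or.inr ⟨fun i hi κ => by
        rw [hR₂row i hi κ]; exact hz i hi κ, ⟨θ₂, hθ₂, hθ₂lam, fun i hi => ?_⟩,
        by rw [hR₁row i₀ hi₀ 0, hR₁row i₀ hi₀ 1]; exact hmem, ?_⟩⟩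
    · rw [hG θ₁ i 0 (by decide), hG θ₁ i 1 (by decide)]; exact hG₁ i hi
    · rw [hG θ₂ i 2 (by decide), hG θ₂ i 3 (by decide)]; exact hG₂ i hi
    · rcases hnf with hall | ⟨i₁, ρ, hpiv, habove, hbefore⟩
      · exact Or.inl hall
      · have h4₁ : ∀ i ∈ R₁, ∀ κ, β₂.w i κ 4 = 0 := fun i hi κ => by
          rw [hR₁row i hi κ]; exact (hs₁ i hi κ).2.2
        have h4₂ : ∀ i ∈ R₂, ∀ κ, β₂.w i κ 4 = 0 := fun i hi κ => by
          rw [hR₂row i hi κ]; exact (hz i hi κ).2.2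
        have hone : β₂.w i₁ ρ 4 = 1 := by rw [hpiv]; simp
        have hn : ∀ R : Finset ι, (∀ i ∈ R, ∀ κ, β₂.w i κ 4 = 0) → i₁ ∉ R := fun R hR h => by
          have := hR i₁ h ρ; rw [hone] at this; exact absurd this (by simp)
        refine Or.inr ⟨i₁, hn R₁ h4₁, hn R₂ h4₂, hbefore, ?_⟩
        fin_cases ρ
        · exact Or.inl hpiv
        · exact Or.inr ⟨habove 0 (by decide), hpiv⟩

end Summit.MatrixMultiplication.OmegaCensus.RankOnePlaneCapGeneral
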